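import Literature.NumberTheory.DiophantineGeometry.GenEllThm21With
import Literature.NumberTheory.DiophantineGeometry.GenEllThm21PrimesHolds
import HarnessLib

/-!
# [GenEll] Theorem 2.1 with a height coefficient — the `Λ = 1` REGRESSION FILE: the `With`-vocabulary at
# `Λ = 1` IS the record chain, by name

S. Mochizuki, *Arithmetic elliptic curves in general position*, Math. J. Okayama Univ. 52 (2010)
[cite: MochizukiGenEll2010, Thm 2.1 p.11]. PROOF-ONLY file (0 definitions): the `With`-predicates of
`GenEllThm21With.lean` (R-H round-2 exponent programme, F1; ruling R17: literal reparametrisations of the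
record `ε`-predicates) instantiated at `Λ = 1` recover the tree's record objects BY NAME —

* `genEll_thm21_primesWith_one : GenEll_thm21_primesWith 1` — the `With`-shape of Thm. 2.1 HOLDS at `Λ = 1`,
  being `GenEll_thm21_primes` (`genEll_thm21_primesWith_one_iff`), PROVED in `GenEllThm21PrimesHolds`
  (`GenEll_thm21_primes_holds`, the number-field-only noncritical-Belyi route). For `Λ > 1` the shape is
  NOT in print and NOT in reach of that mechanism (R19 «exponent rigidity», `GenEll.belyi_slope_not_pos`);
  nothing here says anything about `Λ > 1`.
* `vojtaP1DegWith_one_of_abcCompactlyBoundedWith` ((ii)_1 ⇒ (i)_1|_{ℙ¹}, unconditional),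
  `abcWithExponent_one_of_abcCompactlyBounded_primes` / `…_of_abcCompactlyBoundedWith_one` ((ii) ⇒ abc with
  exponent `1`, unconditional = `abc_of_abcCompactlyBounded_of_primes` re-read), and the trivial upgrade
  `abcWithExponent_of_abcCompactlyBounded_primes` to every `Λ ≥ 1`;
* `abc_of_abcWithExponent_one` — `ABCWithExponent 1` gives back, word for word, the displayed abc sentence.

Classical and refereed ([GenEll] is outside the IUT dispute); every statement here is an implication from
the hypothesis (ii) (`ABCCompactlyBounded S`, asserted by nobody) or an unfolding; nothing asserts abc
proved or refuted; nothing bears on [IUTchIII] Cor. 3.12.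
-/

noncomputable section

namespace Literature.NumberTheory.DiophantineGeometry.GenEll

/-- **The `With`-shape of [GenEll] Thm. 2.1 HOLDS at `Λ = 1`**: `GenEll_thm21_primesWith 1`, i.e. (ii) ⇒ (i)|_{ℙ¹}
for every finite set of primes — by `GenEll_thm21_primes_holds` through the `Λ = 1` regression iff. (For
`Λ > 1`: not in print, not in reach — R19.) [cite: MochizukiGenEll2010, Thm 2.1 pp.11–13] -/
theorem genEll_thm21_primesWith_one : GenEll_thm21_primesWith 1 :=
  genEll_thm21_primesWith_one_iff.2 GenEll_thm21_primes_holds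

/-- **(ii)_1 ⇒ (i)_1|_{ℙ¹}** in the `With`-currency, unconditional: for a finite set of primes `S`,
`ABCCompactlyBoundedWith S 1` gives `VojtaP1DegWith d 1` in every degree `d > 0`
(= `vojtaP1Deg_of_abcCompactlyBounded`). [cite: MochizukiGenEll2010, Thm 2.1 pp.11–13] -/
theorem vojtaP1DegWith_one_of_abcCompactlyBoundedWith {S : Finset ℕ} (hS : ∀ p ∈ S, p.Prime)
    (h : ABCCompactlyBoundedWith S 1) {d : ℕ} (hd : 0 < d) : VojtaP1DegWith d 1 :=
  genEll_thm21_primesWith_one S hS h d hd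

/-- **(ii) ⇒ abc with exponent `1`**, unconditional: statement (ii) of Thm. 2.1 at a finite set of primes `S`
implies `ABCWithExponent 1` (= `abc_of_abcCompactlyBounded_of_primes` read through `abcWithExponent_one_iff`).
[cite: MochizukiGenEll2010, Thm 2.1 p.11] -/
theorem abcWithExponent_one_of_abcCompactlyBounded_primes {S : Finset ℕ} (hS : ∀ p ∈ S, p.Prime)
    (h : ABCCompactlyBounded S) : ABCWithExponent 1 :=
  abcWithExponent_one_iff.2 (abc_of_abcCompactlyBounded_of_primes hS h)

/-- The same from the `With`-form of the hypothesis: `ABCCompactlyBoundedWith S 1 → ABCWithExponent 1`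
(`abcExp_of_abcCompactlyBoundedWith` with its shape hypothesis DISCHARGED at `Λ = 1`).
[cite: MochizukiGenEll2010, Thm 2.1 p.11] -/
theorem abcWithExponent_one_of_abcCompactlyBoundedWith_one {S : Finset ℕ} (hS : ∀ p ∈ S, p.Prime)
    (h : ABCCompactlyBoundedWith S 1) : ABCWithExponent 1 :=
  abcExp_of_abcCompactlyBoundedWith genEll_thm21_primesWith_one hS h

/-- **(ii) ⇒ abc with every exponent `Λ ≥ 1`** (the trivial upgrade of the `Λ = 1` chain, `rad ≥ 1`): the
unconditional content the exponent programme starts from. [cite: MochizukiGenEll2010, Thm 2.1 p.11] -/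
theorem abcWithExponent_of_abcCompactlyBounded_primes {S : Finset ℕ} (hS : ∀ p ∈ S, p.Prime)
    (h : ABCCompactlyBounded S) {Λ : ℝ} (hΛ : 1 ≤ Λ) : ABCWithExponent Λ :=
  (abcWithExponent_one_of_abcCompactlyBounded_primes hS h).of_le hΛ

/-- `ABCWithExponent 1` gives back, word for word, the displayed abc sentence of `abc_of_vojtaIneq_one`
(`∀ ε > 0, ∃ C > 0, ∀ abc triples, c < C·rad(abc)^{1+ε}`). [cite: MochizukiGenEll2010, Thm 2.1 p.11] -/
theorem abc_of_abcWithExponent_one (h : ABCWithExponent 1) :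
    ∀ ε : ℝ, 0 < ε → ∃ C : ℝ, 0 < C ∧
      ∀ a b c : ℕ, IsABCTriple a b c → (c : ℝ) < C * ((rad a b c : ℕ) : ℝ) ^ (1 + ε) :=
  abcWithExponent_one_iff.1 h

/-- **The far-from-cusps families at `Λ = 1`**, unconditional: (ii) at `S` gives the abc inequality with
exponent `1+ε` and constants `C(ρ, ε)` on every family of triples `ρ`-far from the cusps at `∞` and at the
primes of `S` — WITHOUT the Belyi transfer (F1 §4 at `Λ = 1`). [cite: MochizukiGenEll2010, Thm 2.1 p.12] -/
theorem abcWithExponentOn_farFromCusps_one_of_abcCompactlyBounded {S : Finset ℕ} (hS : ∀ p ∈ S, p.Prime)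
    (h : ABCCompactlyBounded S) {ρ : ℝ} (h0 : 0 < ρ) (h2 : ρ ≤ 1 / 2) :
    ABCWithExponentOn {P : NFPoint | P.FarFromCusps S ρ} 1 :=
  abcExpOn_farFromCusps_of_abcCompactlyBoundedWith hS ((abcCompactlyBoundedWith_one_iff S).2 h) h0 h2

end Literature.NumberTheory.DiophantineGeometry.GenEll

end
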